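import Literature.Computability.QuantumComplexity.LightConeMachineCone
import Literature.Computability.Complexity.FoldBricks
import HarnessLib

/-!
# The light-cone simulator as an `FP` machine, III: clipped folds, the initial sparse state, applying one gate

Third machine file of the discharge of `Literature.Barriers.QuantumAdvantage.markovShi2008_cor15_anyOrder`
(Markov–Shi 2008, Cor. 1.5, decision form).

* **Clipped folds.** The outer loops of the simulator (doubling the stored labels, applying a
  gate, summing squared norms) grow their accumulator by more than the `FoldGrowth` shape of
  `Brick.foldFn_mem_FP` allows on malformed inputs. Their steps are therefore CLIPPED
  (`Brick.clipF`: the output is cut to `C (|context| + 1)` symbols), which makes the growth bound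
  automatic (`foldGrowth_clipF`); on the intended inputs the accumulator is genuinely short — the
  context carries a polynomial yardstick — so the clipping never acts (`foldl_clip_eq`: a clipped
  fold equals the plain fold as soon as every partial result is short).
* `splitStepF`, **`splitF`** — doubling the stored labels of a state code along the wire at the
  unary position `u`: `splitF ⟨1ⁱ, stEnc st⟩ = stEnc (splitOn i st)` (`splitF_stEnc`), in `FP`;
* **`initPassF`** — the fold of (clipped) `splitF` over the wire numerals of `S` from
  `stEnc [(base, 1)]`, on `⟨⟨Y, List.ofFn base⟩, sEnc S⟩`: it computes `stEnc (initState S base)`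
  whenever `2^{|S|} (4N + 54) ≤` the input length (`initPassF_spec`), and is in `FP`;
* the parameters of a gate: `⟨⟨op, ⟨1ⁱ, 1ʲ⟩⟩, Y⟩` — the symbol code, the two wire positions in
  unary, and the yardstick `Y` (present only to give the clipping of the new coordinates room);
  `gateParams g Y`;
* `newAmpF` — the new coordinate code of an entry, by dispatch on the symbol: `H` (two lookups, a
  sign, an addition), `S`, `T` (multiplications by `ω`), `CNOT` (one lookup); its value on entry
  codes (`newAmpF_mapRec`, on the step record `mapRec`);
* `mapStepF`, **`applyMapF`** — the fold pushing `⟨label, clipped new code⟩`; `applyMapF_mem_FP`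
  (`FoldGrowth 8`), and **`applyMapF_stEnc`**: on `⟨gateParams g Y, stEnc st⟩` it computes
  `stEnc (applyGate g st)` as soon as every new coordinate code fits in `|Y|` symbols.

## References

* S. Arora, B. Barak, *Computational Complexity: A Modern Approach*, CUP 2009, §1.3 (bounded
  loops), §1.4.1 (clocked simulation).
* M. A. Nielsen, I. L. Chuang, *Quantum Computation and Quantum Information*, CUP 2010, §4.2, Box 4.1.
-/

noncomputable section

namespace Literature.Computability.QuantumComplexity

open _root_.Computability Complexity Complexity.Brick Complexity.Plumb Cryptography

namespace LightCone

attribute [-simp] Brick.nthF_zero Brick.sndPow_zero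

variable {N : ℕ}

/-! ### Clipped fold steps -/

/-- **A clipped step has the fold growth shape**, with the clipping constant. [folklore] -/
theorem foldGrowth_clipF (C : ℕ) (f : List Bool → List Bool) : FoldGrowth C (clipF C f) := fun v =>
  (length_clipF_le C f v).trans (by omega)

/-- **A clipped fold is the plain fold when all partial results are short.** For a fold over the
items `L` with context `w` (step `acc ↦ f ⟨w, ⟨a, acc⟩⟩`), if every partial result — including the
start — has at most `C (|w| + 1)` symbols, clipping the step changes nothing. [folklore] -/
theorem foldl_clip_eq {C : ℕ} {f : List Bool → List Bool} (w : List Bool) (L : List (List Bool)) :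
    ∀ (ini : List Bool),
      (∀ k ≤ L.length, ((L.take k).foldl (fun acc a => f (boolPair w (boolPair a acc))) ini).length ≤ C * (w.length + 1)) →
      L.foldl (fun acc a => clipF C f (boolPair w (boolPair a acc))) ini =
        L.foldl (fun acc a => f (boolPair w (boolPair a acc))) ini := by
  induction L with
  | nil => intro ini _; simp only [List.foldl_nil]
  | cons a L ih =>
    intro ini h
    have h1 : (f (boolPair w (boolPair a ini))).length ≤ C * (w.length + 1) := by
      have := h 1 (by simp)
      simpa using this
    rw [List.foldl_cons, List.foldl_cons, clipF_eq_self (by rwa [fstF_boolPair])]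
    refine ih _ fun k hk => ?_
    have := h (k + 1) (by simpa using hk)
    simpa using this

/-! ### Doubling the stored labels along a wire -/

/-- The unary position (first field of the context `⟨u, st⟩`). [folklore] -/
def spUF : List Bool → List Bool := fstF ∘ nthF 0
/-- The label of the entry. [folklore] -/
def spYF : List Bool → List Bool := fstF ∘ nthF 1
/-- The coordinate code of the entry. [folklore] -/
def spAF : List Bool → List Bool := sndF ∘ nthF 1
/-- The bit of the entry's label at the position. [folklore] -/
def spBT : List Bool → List Bool := bitF spUF spYF
/-- The entry with the bit set. [folklore] -/
def spItem1 : List Bool → List Bool := pr (setF spUF spYF (fun _ => [true])) (iteFn spBT spAF (fun _ => zeroAmpC))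
/-- The entry with the bit cleared. [folklore] -/
def spItem0 : List Bool → List Bool := pr (setF spUF spYF (fun _ => [false])) (iteFn spBT (fun _ => zeroAmpC) spAF)

/-- **One doubling step** on `⟨⟨u, st⟩, ⟨entry, out⟩⟩`: push the two children of the entry
(`LightCone.splitStep`). [folklore] -/
def splitStepF : List Bool → List Bool := pr spItem1 (pr spItem0 (sndPow 1))

/-- **Doubling along a wire**: `⟨u, st⟩ ↦` the fold of `splitStepF` over the entries of `st`.
[folklore] -/
def splitF : List Bool → List Bool := foldFn splitStepF (fun _ => [])

/-- `splitStepF ∈ FP`. [folklore] -/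
theorem splitStepF_mem_FP : splitStepF ∈ FP := by
  have hu : spUF ∈ FP := comp_mem_FP fstF_mem_FP (nthF_mem_FP 0)
  have hy : spYF ∈ FP := comp_mem_FP fstF_mem_FP (nthF_mem_FP 1)
  have ha : spAF ∈ FP := comp_mem_FP sndF_mem_FP (nthF_mem_FP 1)
  have hb : spBT ∈ FP := bitF_mem_FP hu hy
  exact fanoutFn_mem_FP (fanoutFn_mem_FP (setF_mem_FP hu hy (const_mem_FP _)) (iteFn_mem_FP hb ha (const_mem_FP _)))
    (fanoutFn_mem_FP (fanoutFn_mem_FP (setF_mem_FP hu hy (const_mem_FP _)) (iteFn_mem_FP hb (const_mem_FP _) ha))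
      (sndPow_mem_FP 1))

/-- **Growth of the doubling step** (`FoldGrowth 110`): two children, each at most `24` symbols
longer than the entry. [folklore] -/
theorem foldGrowth_splitStepF : FoldGrowth 110 splitStepF := fun v => by
  have hitem := length_fstF_sndF_le (nthF 1 v)
  have h1 : (spItem1 v).length ≤ 2 * (spYF v).length + (spAF v).length + 26 := by
    rw [spItem1, pr_apply, length_boolPair, iteFn_of_oneBit (c := spBT) (oneBit_bitF _ _)]
    have hs := length_setF_le spUF spYF (fun _ => [true]) v
    split_ifs <;> simp only [List.length_singleton, length_zeroAmpC] at hs ⊢ <;> omega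
  have h0 : (spItem0 v).length ≤ 2 * (spYF v).length + (spAF v).length + 26 := by
    rw [spItem0, pr_apply, length_boolPair, iteFn_of_oneBit (c := spBT) (oneBit_bitF _ _)]
    have hs := length_setF_le spUF spYF (fun _ => [false]) v
    split_ifs <;> simp only [List.length_singleton, length_zeroAmpC] at hs ⊢ <;> omega
  rw [splitStepF, pr_apply, length_boolPair, pr_apply, length_boolPair]
  simp only [spYF, spAF, Function.comp_apply, nthF, sndPow] at h1 h0 hitem ⊢
  omega

/-- `splitF ∈ FP`. [folklore] -/
theorem splitF_mem_FP : splitF ∈ FP := foldFn_mem_FP splitStepF_mem_FP (const_mem_FP _) foldGrowth_splitStepF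

/-- **The doubling step on an entry code** is `splitStep`. [folklore] -/
theorem splitStepF_itemEnc (i : Fin N) (st : List Bool) (p : QReg N × Amp) (O : List (QReg N × Amp)) :
    splitStepF (boolPair (boolPair (ones i) st) (boolPair (itemEnc p) (stEnc O))) = stEnc (splitStep i O p) := by
  set v := boolPair (boolPair (ones i) st) (boolPair (itemEnc p) (stEnc O)) with hv
  have hu : spUF v = ones i := by simp [hv, spUF, Brick.nthF_zero]
  have hy : spYF v = List.ofFn p.1 := by simp [hv, spYF, nthF, itemEnc]
  have ha : spAF v = ampEnc p.2 := by simp [hv, spAF, nthF, itemEnc]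
  have hb : spBT v = [p.1 i] := bitF_label hu hy
  have hout : sndPow 1 v = stEnc O := by simp [hv, sndPow]
  have h1 : spItem1 v = itemEnc (Function.update p.1 i true, if p.1 i = true then p.2 else 0) := by
    rw [spItem1, pr_apply, setF_label (b := fun _ => [true]) hu hy rfl, iteFn_apply hb, ha, itemEnc]
    cases p.1 i <;> rfl
  have h0 : spItem0 v = itemEnc (Function.update p.1 i false, if p.1 i = true then 0 else p.2) := by
    rw [spItem0, pr_apply, setF_label (b := fun _ => [false]) hu hy rfl, iteFn_apply hb, ha, itemEnc]
    cases p.1 i <;> rfl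
  rw [splitStepF, pr_apply, pr_apply, h1, h0, hout, splitStep, stEnc_cons, stEnc_cons]

/-- **`splitF` computes `splitOn`**: `splitF ⟨1ⁱ, stEnc st⟩ = stEnc (splitOn i st)`. [folklore] -/
theorem splitF_stEnc (i : Fin N) (st : List (QReg N × Amp)) :
    splitF (boolPair (ones i) (stEnc st)) = stEnc (splitOn i st) := by
  rw [splitF, foldFn_boolPair, decNil_stEnc, splitOn]
  suffices h : ∀ (O : List (QReg N × Amp)),
      (st.map itemEnc).foldl (fun acc a => splitStepF (boolPair (boolPair (ones i) (stEnc st)) (boolPair a acc))) (stEnc O) =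
        stEnc (st.foldl (splitStep i) O) by simpa using h []
  generalize stEnc st = ctx
  induction st with
  | nil => intro O; rfl
  | cons p st ih => intro O; rw [List.map_cons, List.foldl_cons, List.foldl_cons, splitStepF_itemEnc, ih]

/-! ### Sizes of the initial states -/

/-- The coordinates of the initial doubling are `0` or `1`. [folklore] -/
theorem snd_mem_initState (S : List (Fin N)) (base : QReg N) :
    ∀ p ∈ initState S base, p.2 = 0 ∨ p.2 = 1 := by
  suffices h : ∀ (st : List (QReg N × Amp)), (∀ p ∈ st, p.2 = 0 ∨ p.2 = 1) →
      ∀ p ∈ S.foldl (fun st i => splitOn i st) st, p.2 = 0 ∨ p.2 = 1 by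
    exact h [(base, 1)] (by simp)
  induction S with
  | nil => intro st hst; simpa using hst
  | cons i S ih =>
    intro st hst p hp
    rw [List.foldl_cons] at hp
    refine ih (splitOn i st) (fun q hq => ?_) p hp
    obtain ⟨r, hr, hq⟩ := (mem_splitOn_iff i st q).1 hq
    rcases hq with rfl | rfl <;> simp only [splitEntry] <;> split_ifs
    · exact hst r hr
    · exact Or.inl rfl
    · exact hst r hr
    · exact Or.inl rfl

/-- An entry of an initial state has at most `2N + 26` symbols. [folklore] -/
theorem length_itemEnc_initState {S : List (Fin N)} {base : QReg N} {p : QReg N × Amp}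
    (hp : p ∈ initState S base) : (itemEnc p).length ≤ 2 * N + 26 := by
  rw [length_itemEnc]
  rcases snd_mem_initState S base p hp with h | h
  · rw [h]; have := length_zeroAmpC; rw [zeroAmpC] at this; omega
  · rw [h]; have := length_oneAmpC; rw [oneAmpC] at this; omega

/-- **Size of an initial state code**: `|stEnc (initState S base)| ≤ 2^{|S|} (4N + 54)`. [folklore] -/
theorem length_stEnc_initState_le (S : List (Fin N)) (base : QReg N) :
    (stEnc (initState S base)).length ≤ 2 ^ S.length * (4 * N + 54) := by
  have h := length_stEnc_le (st := initState S base) (K := 2 * N + 26) fun p hp => length_itemEnc_initState hp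
  rw [length_initState] at h
  have : 2 * (2 * N + 26) + 2 = 4 * N + 54 := by ring
  rw [this] at h
  exact h

/-- Initial states along a prefix of the wire list are initial states. [folklore] -/
theorem foldl_splitOn_take (S : List (Fin N)) (base : QReg N) (k : ℕ) :
    (S.take k).foldl (fun st i => splitOn i st) [(base, 1)] = initState (S.take k) base := rfl

/-! ### The initial pass -/

/-- The base label `w₀` from the fold input `⟨⟨Y, w₀⟩, S⟩` seen as the context (field `0`). [folklore] -/
def ipW0F : List Bool → List Bool := sndF ∘ fstF ∘ nthF 0
/-- The unary position of the wire numeral (the item), measured on the base label. [folklore] -/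
def ipUF : List Bool → List Bool := binToUnaryFn ∘ pr ipW0F (nthF 1)

/-- **One step of the initial pass** (clipped): double the accumulated state along the item's
wire. [folklore] -/
def initStepF : List Bool → List Bool := clipF 1 (splitF ∘ pr ipUF (sndPow 1))

/-- The start of the initial pass: `stEnc [(base, 1)]` from the input `⟨⟨Y, w₀⟩, S⟩`. [folklore] -/
def initIniF : List Bool → List Bool := pr (pr (sndF ∘ fstF) (fun _ => oneAmpC)) (fun _ => [])

/-- **The initial pass**: on `⟨⟨Y, w₀⟩, S⟩`, fold `initStepF` over the wire numerals of `S`.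
[folklore] -/
def initPassF : List Bool → List Bool := foldFn initStepF initIniF

/-- `initStepF ∈ FP`. [folklore] -/
theorem initStepF_mem_FP : initStepF ∈ FP :=
  clipF_mem_FP 1 (comp_mem_FP splitF_mem_FP (fanoutFn_mem_FP
    (comp_mem_FP binToUnaryFn_mem_FP (fanoutFn_mem_FP (comp_mem_FP sndF_mem_FP (comp_mem_FP fstF_mem_FP (nthF_mem_FP 0))) (nthF_mem_FP 1)))
    (sndPow_mem_FP 1)))

/-- **`initPassF ∈ FP`** (clipped step, `foldGrowth_clipF`). [cite: AroraBarak2009, §1.3] -/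
theorem initPassF_mem_FP : initPassF ∈ FP :=
  foldFn_mem_FP initStepF_mem_FP
    (fanoutFn_mem_FP (fanoutFn_mem_FP (comp_mem_FP sndF_mem_FP fstF_mem_FP) (const_mem_FP _)) (const_mem_FP _))
    (foldGrowth_clipF 1 _)

/-- The unclipped initial step on a wire numeral doubles along that wire. [folklore] -/
theorem initStep_plain (Y : List Bool) (base : QReg N) (S : List (Fin N)) (i : Fin N) (st : List (QReg N × Amp)) :
    (splitF ∘ pr ipUF (sndPow 1)) (boolPair (boolPair (boolPair Y (List.ofFn base)) (sEnc S))
      (boolPair (encodeNat (i : ℕ)) (stEnc st))) = stEnc (splitOn i st) := by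
  have hu : ipUF (boolPair (boolPair (boolPair Y (List.ofFn base)) (sEnc S)) (boolPair (encodeNat (i : ℕ)) (stEnc st))) = ones i := by
    have h1 : ipW0F (boolPair (boolPair (boolPair Y (List.ofFn base)) (sEnc S)) (boolPair (encodeNat (i : ℕ)) (stEnc st))) =
        List.ofFn base := by simp [ipW0F, Brick.nthF_zero]
    have h2 : nthF 1 (boolPair (boolPair (boolPair Y (List.ofFn base)) (sEnc S)) (boolPair (encodeNat (i : ℕ)) (stEnc st))) =
        encodeNat (i : ℕ) := by simp [nthF]
    rw [ipUF, Function.comp_apply, pr_apply, h1, h2]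
    exact ADH.binToUnaryFn_label base i
  have h3 : sndPow 1 (boolPair (boolPair (boolPair Y (List.ofFn base)) (sEnc S)) (boolPair (encodeNat (i : ℕ)) (stEnc st))) =
      stEnc st := by simp [sndPow]
  rw [Function.comp_apply, pr_apply, hu, h3]
  exact splitF_stEnc i st

/-- **The initial pass computes `initState`** when the input is long enough for the clipping
never to act: `2^{|S|} (4N + 54) ≤ |input| + 1`. [folklore] -/
theorem initPassF_spec (Y : List Bool) (S : List (Fin N)) (base : QReg N)
    (hsize : 2 ^ S.length * (4 * N + 54) ≤ (boolPair (boolPair Y (List.ofFn base)) (sEnc S)).length + 1) :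
    initPassF (boolPair (boolPair Y (List.ofFn base)) (sEnc S)) = stEnc (initState S base) := by
  set w := boolPair (boolPair Y (List.ofFn base)) (sEnc S) with hw
  have hini : initIniF w = stEnc [(base, 1)] := by
    simp [hw, initIniF, stEnc, itemEnc, oneAmpC, encList_cons]
  rw [initPassF, foldFn_apply, hini]
  have hsnd : sndF w = sEnc S := by rw [hw, sndF_boolPair]
  rw [hsnd, sEnc, decNil_encList, initStepF]
  -- the plain fold computes `initState` along every prefix
  have plain : ∀ (T : List (Fin N)) (st : List (QReg N × Amp)),
      (T.map fun i : Fin N => encodeNat i.val).foldl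
        (fun acc a => (splitF ∘ pr ipUF (sndPow 1)) (boolPair w (boolPair a acc))) (stEnc st) =
        stEnc (T.foldl (fun st i => splitOn i st) st) := by
    intro T
    induction T with
    | nil => intro st; rfl
    | cons i T ih => intro st; rw [List.map_cons, List.foldl_cons, List.foldl_cons, hw, initStep_plain, ← hw, ih]
  rw [foldl_clip_eq w _ _ (fun k hk => ?_), plain S [(base, 1)]]
  · rfl
  · rw [← List.map_take, plain (S.take k) [(base, 1)], foldl_splitOn_take]
    refine (length_stEnc_initState_le (S.take k) base).trans ?_
    have hk' : (S.take k).length ≤ S.length := by simp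
    calc 2 ^ (S.take k).length * (4 * N + 54) ≤ 2 ^ S.length * (4 * N + 54) :=
          Nat.mul_le_mul_right _ (Nat.pow_le_pow_right (by norm_num) hk')
      _ ≤ w.length + 1 := hsize
      _ = 1 * (w.length + 1) := (one_mul _).symm


/-! ### The parameters of a gate -/

/-- The symbol code of a Clifford+`T` gate (`ε, 1, 01, 11`). [folklore] -/
def opCode : QGate cliffordT N → List Bool
  | .gate .H _ => []
  | .gate .S _ => [true]
  | .gate .T _ => [false, true]
  | .gate .CNOT _ => [true, true]
  | .oracle _ _ => [true, true]

/-- The first wire of a gate, in unary. [folklore] -/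
def uiCode : QGate cliffordT N → List Bool
  | .gate .H e => ones (embH e 0)
  | .gate .S e => ones (embS e 0)
  | .gate .T e => ones (embT e 0)
  | .gate .CNOT e => ones (embC e 0)
  | .oracle _ _ => []

/-- The second wire of a gate, in unary (`ε` for one-qubit gates). [folklore] -/
def ujCode : QGate cliffordT N → List Bool
  | .gate .CNOT e => ones (embC e 1)
  | _ => []

/-- **The parameter record of a gate**: `⟨⟨op, ⟨1ⁱ, 1ʲ⟩⟩, Y⟩`. [folklore] -/
def gateParams (g : QGate cliffordT N) (Y : List Bool) : List Bool :=
  boolPair (boolPair (opCode g) (boolPair (uiCode g) (ujCode g))) Y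

/-! ### Field accessors of the map step `⟨⟨params, st⟩, ⟨entry, out⟩⟩` -/

/-- The parameter block `⟨op, ⟨1ⁱ, 1ʲ⟩⟩`. [folklore] -/
def gPF : List Bool → List Bool := fstF ∘ fstF ∘ nthF 0
/-- The symbol code. [folklore] -/
def gOpF : List Bool → List Bool := fstF ∘ gPF
/-- The first wire position, unary. [folklore] -/
def gUiF : List Bool → List Bool := fstF ∘ sndF ∘ gPF
/-- The second wire position, unary. [folklore] -/
def gUjF : List Bool → List Bool := sndF ∘ sndF ∘ gPF
/-- The old state code (for lookups). [folklore] -/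
def gStF : List Bool → List Bool := sndF ∘ nthF 0
/-- The entry's label. [folklore] -/
def gYF : List Bool → List Bool := fstF ∘ nthF 1
/-- The entry's coordinate code. [folklore] -/
def gAF : List Bool → List Bool := sndF ∘ nthF 1
/-- The bit of the label on the first wire. [folklore] -/
def gBiT : List Bool → List Bool := bitF gUiF gYF
/-- The bit of the label on the second wire. [folklore] -/
def gBjT : List Bool → List Bool := bitF gUjF gYF
/-- Lookup of the label with the first-wire bit cleared. [folklore] -/
def gL0F : List Bool → List Bool := lookupF ∘ pr (setF gUiF gYF (fun _ => [false])) gStF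
/-- Lookup of the label with the first-wire bit set. [folklore] -/
def gL1F : List Bool → List Bool := lookupF ∘ pr (setF gUiF gYF (fun _ => [true])) gStF
/-- New code after `H`: `L₀ ± L₁`. [folklore] -/
def newHF : List Bool → List Bool := addAmpF ∘ pr gL0F (iteFn gBiT (negAmpF ∘ gL1F) gL1F)
/-- New code after `S`: `ω^{2b} a`. [folklore] -/
def newSGF : List Bool → List Bool := iteFn gBiT (mulOmegaF ∘ mulOmegaF ∘ gAF) gAF
/-- New code after `T`: `ω^{b} a`. [folklore] -/
def newTF : List Bool → List Bool := iteFn gBiT (mulOmegaF ∘ gAF) gAF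
/-- New code after `CNOT`: lookup of the label with the target bit flipped by the control bit.
[folklore] -/
def newCF' : List Bool → List Bool := lookupF ∘ pr (setF gUjF gYF (ADH.xorT gBjT gBiT)) gStF

/-- **The new coordinate code of the entry**, by dispatch on the symbol code. [folklore] -/
def newAmpF : List Bool → List Bool :=
  iteFn (ADH.nilT gOpF) newHF (iteFn (ADH.eqC [true] gOpF) newSGF (iteFn (ADH.eqC [false, true] gOpF) newTF newCF'))

/-- **One step of the map**: push `⟨label, new code⟩`, the new code clipped to `|⟨params, st⟩| + 1`
symbols. [folklore] -/
def mapStepF : List Bool → List Bool := pr (pr gYF (clipF 1 newAmpF)) (sndPow 1)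

/-- **Applying a gate**: `⟨params, st⟩ ↦` the fold of `mapStepF` over the entries of `st`.
[folklore] -/
def applyMapF : List Bool → List Bool := foldFn mapStepF (fun _ => [])

/-! ### Membership in `FP` -/

/-- `gPF ∈ FP`. [folklore] -/
theorem gPF_mem_FP : gPF ∈ FP := comp_mem_FP fstF_mem_FP (comp_mem_FP fstF_mem_FP (nthF_mem_FP 0))
/-- `gOpF ∈ FP`. [folklore] -/
theorem gOpF_mem_FP : gOpF ∈ FP := comp_mem_FP fstF_mem_FP gPF_mem_FP
/-- `gUiF ∈ FP`. [folklore] -/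
theorem gUiF_mem_FP : gUiF ∈ FP := comp_mem_FP fstF_mem_FP (comp_mem_FP sndF_mem_FP gPF_mem_FP)
/-- `gUjF ∈ FP`. [folklore] -/
theorem gUjF_mem_FP : gUjF ∈ FP := comp_mem_FP sndF_mem_FP (comp_mem_FP sndF_mem_FP gPF_mem_FP)
/-- `gStF ∈ FP`. [folklore] -/
theorem gStF_mem_FP : gStF ∈ FP := comp_mem_FP sndF_mem_FP (nthF_mem_FP 0)
/-- `gYF ∈ FP`. [folklore] -/
theorem gYF_mem_FP : gYF ∈ FP := comp_mem_FP fstF_mem_FP (nthF_mem_FP 1)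
/-- `gAF ∈ FP`. [folklore] -/
theorem gAF_mem_FP : gAF ∈ FP := comp_mem_FP sndF_mem_FP (nthF_mem_FP 1)
/-- `gBiT ∈ FP`. [folklore] -/
theorem gBiT_mem_FP : gBiT ∈ FP := bitF_mem_FP gUiF_mem_FP gYF_mem_FP
/-- `gBjT ∈ FP`. [folklore] -/
theorem gBjT_mem_FP : gBjT ∈ FP := bitF_mem_FP gUjF_mem_FP gYF_mem_FP
/-- `gL0F ∈ FP`. [folklore] -/
theorem gL0F_mem_FP : gL0F ∈ FP :=
  comp_mem_FP lookupF_mem_FP (fanoutFn_mem_FP (setF_mem_FP gUiF_mem_FP gYF_mem_FP (const_mem_FP _)) gStF_mem_FP)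
/-- `gL1F ∈ FP`. [folklore] -/
theorem gL1F_mem_FP : gL1F ∈ FP :=
  comp_mem_FP lookupF_mem_FP (fanoutFn_mem_FP (setF_mem_FP gUiF_mem_FP gYF_mem_FP (const_mem_FP _)) gStF_mem_FP)
/-- `newHF ∈ FP`. [folklore] -/
theorem newHF_mem_FP : newHF ∈ FP :=
  comp_mem_FP addAmpF_mem_FP (fanoutFn_mem_FP gL0F_mem_FP (iteFn_mem_FP gBiT_mem_FP (comp_mem_FP negAmpF_mem_FP gL1F_mem_FP) gL1F_mem_FP))
/-- `newSGF ∈ FP`. [folklore] -/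
theorem newSGF_mem_FP : newSGF ∈ FP :=
  iteFn_mem_FP gBiT_mem_FP (comp_mem_FP mulOmegaF_mem_FP (comp_mem_FP mulOmegaF_mem_FP gAF_mem_FP)) gAF_mem_FP
/-- `newTF ∈ FP`. [folklore] -/
theorem newTF_mem_FP : newTF ∈ FP := iteFn_mem_FP gBiT_mem_FP (comp_mem_FP mulOmegaF_mem_FP gAF_mem_FP) gAF_mem_FP
/-- `newCF' ∈ FP`. [folklore] -/
theorem newCF'_mem_FP : newCF' ∈ FP :=
  comp_mem_FP lookupF_mem_FP (fanoutFn_mem_FP (setF_mem_FP gUjF_mem_FP gYF_mem_FP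
    (ADH.xorT_mem_FP gBjT_mem_FP gBiT_mem_FP)) gStF_mem_FP)
/-- `newAmpF ∈ FP`. [folklore] -/
theorem newAmpF_mem_FP : newAmpF ∈ FP :=
  iteFn_mem_FP (ADH.nilT_mem_FP gOpF_mem_FP) newHF_mem_FP (iteFn_mem_FP (ADH.eqC_mem_FP _ gOpF_mem_FP) newSGF_mem_FP
    (iteFn_mem_FP (ADH.eqC_mem_FP _ gOpF_mem_FP) newTF_mem_FP newCF'_mem_FP))
/-- `mapStepF ∈ FP`. [folklore] -/
theorem mapStepF_mem_FP : mapStepF ∈ FP :=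
  fanoutFn_mem_FP (fanoutFn_mem_FP gYF_mem_FP (clipF_mem_FP 1 newAmpF_mem_FP)) (sndPow_mem_FP 1)

/-- **Growth of the map step** (`FoldGrowth 8`): the label is half the entry, the clipped code is
at most `|context| + 1`. [folklore] -/
theorem foldGrowth_mapStepF : FoldGrowth 8 mapStepF := fun v => by
  have hitem := length_fstF_sndF_le (nthF 1 v)
  have hclip := length_clipF_le 1 newAmpF v
  rw [mapStepF, pr_apply, length_boolPair, pr_apply, length_boolPair]
  simp only [gYF, Function.comp_apply, nthF, sndPow] at hitem hclip ⊢
  omega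

/-- **`applyMapF ∈ FP`.** [cite: AroraBarak2009, §1.3] -/
theorem applyMapF_mem_FP : applyMapF ∈ FP := foldFn_mem_FP mapStepF_mem_FP (const_mem_FP _) foldGrowth_mapStepF

/-! ### The value of the map step on an entry code -/

section Value

variable (g : QGate cliffordT N) (Y : List Bool) (st : List (QReg N × Amp)) (p : QReg N × Amp) (out : List Bool)

/-- The step record for the entry `p` of the state `st` under the gate `g`. [folklore] -/
def mapRec : List Bool := boolPair (boolPair (gateParams g Y) (stEnc st)) (boolPair (itemEnc p) out)

/-- The fields of the step record. [folklore] -/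
theorem mapRec_fields :
    gOpF (mapRec g Y st p out) = opCode g ∧ gUiF (mapRec g Y st p out) = uiCode g ∧
      gUjF (mapRec g Y st p out) = ujCode g ∧ gStF (mapRec g Y st p out) = stEnc st ∧
      gYF (mapRec g Y st p out) = List.ofFn p.1 ∧ gAF (mapRec g Y st p out) = ampEnc p.2 ∧
      sndPow 1 (mapRec g Y st p out) = out ∧ nthF 0 (mapRec g Y st p out) = boolPair (gateParams g Y) (stEnc st) := by
  simp [mapRec, gateParams, gOpF, gUiF, gUjF, gPF, gStF, gYF, gAF, itemEnc, nthF, sndPow]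

/-- The new code of an entry under an `H` gate. [folklore] -/
theorem newAmpF_mapRec_H (e : Fin (cliffordT.arity CliffordTOp.H) ↪ Fin N) :
    newAmpF (mapRec (QGate.gate CliffordTOp.H e) Y st p out) = ampEnc (newAmp st (QGate.gate CliffordTOp.H e) p) := by
  obtain ⟨hop, hui, -, hst, hy, -, -, -⟩ := mapRec_fields (QGate.gate CliffordTOp.H e) Y st p out
  simp only [opCode, uiCode] at hop hui
  have hb : gBiT (mapRec (QGate.gate CliffordTOp.H e) Y st p out) = [p.1 (embH e 0)] := bitF_label hui hy
  have hL0 : gL0F (mapRec (QGate.gate CliffordTOp.H e) Y st p out) = ampEnc (lookup st (Function.update p.1 (embH e 0) false)) := by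
    rw [gL0F, Function.comp_apply, pr_apply, setF_label (b := fun _ => [false]) hui hy rfl, hst]
    exact lookupF_stEnc _ _
  have hL1 : gL1F (mapRec (QGate.gate CliffordTOp.H e) Y st p out) = ampEnc (lookup st (Function.update p.1 (embH e 0) true)) := by
    rw [gL1F, Function.comp_apply, pr_apply, setF_label (b := fun _ => [true]) hui hy rfl, hst]
    exact lookupF_stEnc _ _
  rw [newAmpF, iteFn_apply (ADH.nilT_apply gOpF (mapRec _ Y st p out)), hop]
  simp only [decide_true, if_true]
  rw [newHF, Function.comp_apply, pr_apply, hL0, iteFn_apply hb]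
  cases hpi : p.1 (embH e 0)
  · simp only [Bool.false_eq_true, if_false, hL1, addAmpF_boolPair, newAmp, hpi]
  · simp only [if_true, Function.comp_apply, hL1, negAmpF_ampEnc, addAmpF_boolPair, newAmp, hpi]

/-- The new code of an entry under an `S` gate. [folklore] -/
theorem newAmpF_mapRec_S (e : Fin (cliffordT.arity CliffordTOp.S) ↪ Fin N) :
    newAmpF (mapRec (QGate.gate CliffordTOp.S e) Y st p out) = ampEnc (newAmp st (QGate.gate CliffordTOp.S e) p) := by
  obtain ⟨hop, hui, -, -, hy, ha, -, -⟩ := mapRec_fields (QGate.gate CliffordTOp.S e) Y st p out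
  simp only [opCode, uiCode] at hop hui
  have hb : gBiT (mapRec (QGate.gate CliffordTOp.S e) Y st p out) = [p.1 (embS e 0)] := bitF_label hui hy
  rw [newAmpF, iteFn_apply (ADH.nilT_apply gOpF (mapRec _ Y st p out)), hop]
  simp only [List.cons_ne_nil, decide_false, Bool.false_eq_true, if_false]
  rw [iteFn_apply (ADH.eqC_apply _ gOpF (mapRec _ Y st p out)), hop]
  simp only [decide_true, if_true]
  rw [newSGF, iteFn_apply hb]
  cases hpi : p.1 (embS e 0)
  · simp only [Bool.false_eq_true, if_false, ha, newAmp, hpi]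
  · simp only [if_true, Function.comp_apply, ha, mulOmegaF_ampEnc, newAmp, hpi]

/-- The new code of an entry under a `T` gate. [folklore] -/
theorem newAmpF_mapRec_T (e : Fin (cliffordT.arity CliffordTOp.T) ↪ Fin N) :
    newAmpF (mapRec (QGate.gate CliffordTOp.T e) Y st p out) = ampEnc (newAmp st (QGate.gate CliffordTOp.T e) p) := by
  obtain ⟨hop, hui, -, -, hy, ha, -, -⟩ := mapRec_fields (QGate.gate CliffordTOp.T e) Y st p out
  simp only [opCode, uiCode] at hop hui
  have hb : gBiT (mapRec (QGate.gate CliffordTOp.T e) Y st p out) = [p.1 (embT e 0)] := bitF_label hui hy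
  rw [newAmpF, iteFn_apply (ADH.nilT_apply gOpF (mapRec _ Y st p out)), hop]
  simp only [List.cons_ne_nil, decide_false, Bool.false_eq_true, if_false]
  rw [iteFn_apply (ADH.eqC_apply _ gOpF (mapRec _ Y st p out)), hop]
  simp only [List.cons.injEq, Bool.false_eq_true, false_and, decide_false, if_false]
  rw [iteFn_apply (ADH.eqC_apply _ gOpF (mapRec _ Y st p out)), hop]
  simp only [decide_true, if_true]
  rw [newTF, iteFn_apply hb]
  cases hpi : p.1 (embT e 0)
  · simp only [Bool.false_eq_true, if_false, ha, newAmp, hpi]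
  · simp only [if_true, Function.comp_apply, ha, mulOmegaF_ampEnc, newAmp, hpi]

/-- The new code of an entry under a `CNOT` gate. [folklore] -/
theorem newAmpF_mapRec_CNOT (e : Fin (cliffordT.arity CliffordTOp.CNOT) ↪ Fin N) :
    newAmpF (mapRec (QGate.gate CliffordTOp.CNOT e) Y st p out) = ampEnc (newAmp st (QGate.gate CliffordTOp.CNOT e) p) := by
  obtain ⟨hop, hui, huj, hst, hy, -, -, -⟩ := mapRec_fields (QGate.gate CliffordTOp.CNOT e) Y st p out
  simp only [opCode, uiCode, ujCode] at hop hui huj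
  have hbi : gBiT (mapRec (QGate.gate CliffordTOp.CNOT e) Y st p out) = [p.1 (embC e 0)] := bitF_label hui hy
  have hbj : gBjT (mapRec (QGate.gate CliffordTOp.CNOT e) Y st p out) = [p.1 (embC e 1)] := bitF_label huj hy
  rw [newAmpF, iteFn_apply (ADH.nilT_apply gOpF (mapRec _ Y st p out)), hop]
  simp only [List.cons_ne_nil, decide_false, Bool.false_eq_true, if_false]
  rw [iteFn_apply (ADH.eqC_apply _ gOpF (mapRec _ Y st p out)), hop]
  simp only [List.cons.injEq, List.cons_ne_nil, and_false, decide_false, Bool.false_eq_true, if_false]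
  rw [iteFn_apply (ADH.eqC_apply _ gOpF (mapRec _ Y st p out)), hop]
  simp only [List.cons.injEq, Bool.true_eq_false, false_and, decide_false, Bool.false_eq_true, if_false]
  rw [newCF', Function.comp_apply, pr_apply, setF_label huj hy (ADH.xorT_apply hbj hbi), hst]
  exact lookupF_stEnc _ _

/-- **The new code of an entry is `newAmp`** (oracle-free gate). [folklore] -/
theorem newAmpF_mapRec (hg : g.IsOracleFree) : newAmpF (mapRec g Y st p out) = ampEnc (newAmp st g p) := by
  cases g with
  | oracle k e => exact absurd hg id
  | gate op e =>
    cases op with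
    | H => exact newAmpF_mapRec_H Y st p out e
    | S => exact newAmpF_mapRec_S Y st p out e
    | T => exact newAmpF_mapRec_T Y st p out e
    | CNOT => exact newAmpF_mapRec_CNOT Y st p out e

/-- **The map step on an entry code**: push `⟨label, new code⟩` when the new code fits in
`|⟨params, st⟩| + 1` symbols. [folklore] -/
theorem mapStepF_mapRec (hg : g.IsOracleFree)
    (hfit : (ampEnc (newAmp st g p)).length ≤ (boolPair (gateParams g Y) (stEnc st)).length + 1) :
    mapStepF (mapRec g Y st p out) = boolPair (itemEnc (p.1, newAmp st g p)) out := by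
  obtain ⟨-, -, -, -, hy, -, hout, h0⟩ := mapRec_fields g Y st p out
  have hclip : clipF 1 newAmpF (mapRec g Y st p out) = ampEnc (newAmp st g p) := by
    rw [clipF_eq_self, newAmpF_mapRec g Y st p out hg]
    rw [newAmpF_mapRec g Y st p out hg, ← Brick.nthF_zero, h0, one_mul]
    exact hfit
  rw [mapStepF, pr_apply, pr_apply, hy, hclip, hout, itemEnc]

end Value

/-- **`applyMapF` computes `applyGate`**: on `⟨gateParams g Y, stEnc st⟩` (oracle-free `g`) it
returns `stEnc (applyGate g st)`, provided every new coordinate code has at most `|Y|` symbols.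
[folklore] -/
theorem applyMapF_stEnc (g : QGate cliffordT N) (hg : g.IsOracleFree) (Y : List Bool) (st : List (QReg N × Amp))
    (hfit : ∀ p ∈ st, (ampEnc (newAmp st g p)).length ≤ Y.length) :
    applyMapF (boolPair (gateParams g Y) (stEnc st)) = stEnc (applyGate g st) := by
  rw [applyMapF, foldFn_boolPair, decNil_stEnc, applyGate]
  have hfit' : ∀ p ∈ st, (ampEnc (newAmp st g p)).length ≤ (boolPair (gateParams g Y) (stEnc st)).length + 1 :=
    fun p hp => (hfit p hp).trans (by simp only [length_boolPair, gateParams]; omega)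
  suffices h : ∀ (items : List (QReg N × Amp)) (O : List (QReg N × Amp)), (∀ p ∈ items, p ∈ st) →
      (items.map itemEnc).foldl (fun acc a => mapStepF (boolPair (boolPair (gateParams g Y) (stEnc st)) (boolPair a acc))) (stEnc O) =
        stEnc (items.foldl (fun out p => (p.1, newAmp st g p) :: out) O) by
    simpa using h st [] (fun p hp => hp)
  intro items
  induction items with
  | nil => intro O _; rfl
  | cons p items ih =>
    intro O hsub
    rw [List.map_cons, List.foldl_cons, List.foldl_cons]
    have h1 := mapStepF_mapRec g Y st p (stEnc O) hg (hfit' p (hsub p List.mem_cons_self))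
    rw [mapRec] at h1
    rw [h1, ← stEnc_cons]
    exact ih _ fun q hq => hsub q (List.mem_cons_of_mem p hq)

end LightCone

end Literature.Computability.QuantumComplexity

end
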